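import Summits.BirchSwinnertonDyer.Rank1Residual.X11b.JetchevIndexRecordsKit
import HarnessLib

/-!
# BSD rank-≤1 residual cell, lane class X11b (`p ∥ N`: MULTIPLICATIVE at a prime `p ≥ 5`, `ρ̄_{E,p}` onto), rank ONE,
# Tamagawa-OBSTRUCTED with ONE Tamagawa prime: `BSD(E,p)` PER PAIR from Miller 2011 Thm. 5.4 (Cha case; FLAGGED) + GZK +
# a two-engine Jetchev HEEGNER-INDEX certificate in a DEEP field, the Tamagawa half and `E[p]` irreducible IN THE KERNEL — records 05

HONEST FRAMING (cell `b2b-bsdres-*`, verbatim): prove what is provable now; shrink each hard class to its core with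
data; no claim beyond stated classes; COMBINATION classes deleted from PUBLISHED theorems only, CONSTRUCTION-shaped
remainder typed; this is not "finishing BSD". X11b stays CONSTRUCTION-SHAPED; everything here is PER PAIR; no lane
verdict is changed; no named fact is introduced (debt 0: `hMJ`, `hGZK` are the tree's existing published named facts,
`hMJ` = Miller 2011 Thm. 5.4 in the Cha case carries the registry FLAGS `Miller11-Thm54-Cha-case` and `JET@p|N` —
these records are LITERAL currency, flag-free only the day director-bsd's ITEM (J∥) lands); nothing is booked by this
unit (census-lead, the Kurihara lane, the x11b lineage, bsd-jet and referee A decide what a record is worth); Cremona's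
numbers (`r_an = 1`, `#Ш_an`, models, generators, `∏ c_ℓ`, torsion, optimality / Manin codes, the galrep datum) and
the lane's per-prime `bad` tables are INPUTS.

Unit `b2b-bsdres-x11c`, GEN 33 (prover-b2b-bsdres-x11c-g33-0), move «JDEEP». POPULATION (`HOME/b2b-bsdres-x11c/gen33/jdeep/pop/`:
gen 32's class census `harvest_x11b_all.json` restricted to shape `tamobs` × this gen's zero-compute J-shape census of the
lane's own per-prime tables): of the 3 062 rank-ONE X11b cells at `p ≥ 5` that are OPEN on the Kurihara lane's residue of
record (bsdN sweep v4u/v5u) with `ρ̄_{E,p}` onto, `p ∤ #E(ℚ)_tors`, `p ∤ #Ш_an` but `p ∣ ∏ c_ℓ` (outside the Kolyvagin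
road of GEN 32's `KolyvaginIndexRecordsX11bRankOne01–95`), exactly **98 are «J1»: ONE prime `q ∣ N` with `p ∣ c_q`**
(always split multiplicative `Iₙ`, `w := ord_p c_q = ord_p n`; 82 @5, 15 @7, 1 @13; `q = p` itself for 27), 2 901 are J2
and 63 J3 (two / three such primes). For a J1 cell the Jetchev MAX-form bound `ord_p #Ш(E/ℚ) ≤ 2(ord_p [E(K):ℤy_K] −
max_q ord_p c_q)` reaches `0` in a Heegner field `K` with `ord_p [E(K):ℤy_K] = w` (Gross–Zagier + BSD over `K` predict
`ord_p [E(K):ℤy_K] = Σ_q ord_p c_q + ½ ord_p #Ш(E/K)`); the lane's fields of record (`|D| ≤ 1511`) read `w + 1` on every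
one of these 98 cells (the J1 cells with a `w`-field were booked T-JET literal and left the residue), so this gen ran the
cell's engine 1 DEEPER (VERBATIM, `NDISC 16` / `DBOUND 6000`) and found a `w`-field for the rows below; engine 2
(VERBATIM stdlib re-implementation) recomputes `m` EQUAL; the twist side (`E^D`: `#Ш_an`, `∏c`, torsion) is printed per
row (BSD-consistency: `ord_p #Ш_an(E^D) = 0`, `ord_p ∏c(E^D) = w`); the Tamagawa prime has THREE engines (A = Tate's
algorithm `tateY`, B = PARI `elllocalred`, C = the rank-2 observatory's certificate engine whose `TamLocal` certificate the
KERNEL re-checks). Kit jobs: engine 1 j268106 (14 c, 54 min), very deep j269293 (460020m1); engine 2 + twist values + Tamagawa engine B j269294 (8 c, 50 min); PARI third check j270395. Each record `bsdp_j<label>_<p>` is ONE application of the GEN 33 kit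
`X11b.bsdp_prime_of_jetchevIndex_of_tamLocal[_support]` (p496494; = the unit's gen-4 route
`bsdp_of_ainvs_of_jetchevChaCertificate` + kernel minimality + kernel irreducibility + n1011's kernel `c_q` transport) with
`decide` goals; binders displayed: `hMJ` (FLAGGED), `hGZK`, the Heegner datum (`K`, `p ∤ d_K`, `p² ∤ N`, `P = y_K` of
infinite order), `q ∣ N`, the index line `hv : ord_p [E(K):ℤP] ≤ w`, `r_an ≤ 1`, `#Ш_an` a `p`-adic unit. Currency:
LITERAL (the lane's T-JET row with flag `JET@p|N`; bucket-B-shaped for bsd-jet); every one of the 98 cells ALSO carries the unit's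
GEN 10 beyond-window DATA record (`X11b/BeyondWindowRecordsNN` ×95 / `BeyondWindowSurjRecordsNN` ×3, Skinner 2016 Thm. A /
Kato–Wuthrich road, binders as displayed there) — these records are a SECOND road for them. Table `HOME/b2b-bsdres-x11c/gen33/jdeep/JDEEP-TABLE.md`; population `jdeep/pop/JDEEP-POP.md`; J-shape census
`jdeep/pop/census_jpar.json`. Pairs in this file: `355110cd1`@5, `360570be1`@5, `365490r1`@5, `367710cl1`@5, `370110ce1`@5, `379890h1`@5, `381570ca1`@5, `383040dq1`@5, `383040mo1`@5, `384720bw1`@5.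

References: R. L. Miller, LMS J. Comput. Math. 14 (2011) Thm. 5.4, Thm. 5.2, Thm. 4.1, Cor. 4.8, Def. 1.1 [Miller2011LMS];
D. Jetchev, Compos. Math. 144 (2008) Thm. 1.1 [Jetchev2008]; B. H. Gross, D. Zagier, Invent. Math. 84 (1986) I (6.5)
[GrossZagier1986]; B. Mazur, Invent. Math. 44 (1978) Prop. 6.3 (1) [Mazur1978]; J. Tate, LNM 476 (1975) §7 [Tate1975];
J. H. Silverman, GTM 151 (1994) IV.9.4 [Silverman1994]; J. H. Silverman, *AEC* (2009) VII.1 Rem. 1.1, VII.6 Ex. 7.6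
[SilvermanAEC2009]; A. Kraus, Acta Arith. 54 (1989) [Kraus1989]; J. E. Cremona, *Algorithms for Modular Elliptic Curves*
(1997) §3.2, Table 1 [CremonaAlgorithms1997]; Cremona's tables [Cremona2006].
-/

set_option autoImplicit false

noncomputable section

open scoped Classical

open WeierstrassCurve Literature.NumberTheory.EllipticCurves
  Literature.NumberTheory.EllipticCurves.Rank1Residual
  Literature.NumberTheory.EllipticCurves.Rank1Residual.Typed
  Literature.NumberTheory.EllipticCurves.Miller2011
  Literature.NumberTheory.EllipticCurves.Rank1Residual.X11RankOneCertificates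
  Summit.BirchSwinnertonDyer.BirchSwinnertonDyer.Rank1Residual.IntModel
  Summit.BirchSwinnertonDyer.BirchSwinnertonDyer.Rank1Residual.X11RankOne
  Summit.BirchSwinnertonDyer.BirchSwinnertonDyer.Rank2Observatory.Tam
  Summit.BirchSwinnertonDyer.Rank1Residual.Additive

namespace Summit.BirchSwinnertonDyer.Rank1Residual.X11b

/-- **`BSD(E,5)` for `355110cd1`** (`N = 355110 = 2·3·5·7·19·89`; SPLIT MULTIPLICATIVE at `5` (Kodaira `I5`, `c_5 = 5`); `#tors = 1`, `∏c = 60`,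
`r_an = 1`, `#Ш_an = 1`, `ρ̄_{E,5}` onto (Cremona galrep: no code); lane residue cell `(5, X11b)` (bsdN v4u/v5u of record: `residue:X11b`);
ALSO the unit's GEN 10 beyond-window DATA record in `X11b/BeyondWindowRecords45.lean` (binders as displayed there)). Tamagawa-OBSTRUCTED, shape J1: the ONLY prime `q ∣ N` with `5 ∣ c_q` is `q = p = 5` itself (Kodaira `I5` split, `c_5 = 5`, `w = ord_5 c_5 = 1`) — engines A (Tate `tateY`) = B (PARI
`elllocalred`, j269294) = C (observatory `TamLocal` ⟨5, 2, 1, 1, 0, 0, 0, 5, 0, 0, 5⟩, re-checked by the kernel below). Lane fields of record (`|D| ≤ 1511`): `-1319`: `m = 600` (`ord = 2`).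
DEEP FIELD `D = -1511` (prime): **`m = [E(K):ℤy_K] = 360`, `ord_5 m = 1 = w`** (`ρ = 32400`; `L'(E,1) = 20.82818181`, `L(E^D,1) = 9.525014378`, `ĥ(x) = 1.98574256`; `N_{E^D} = 810759098310`)
— engine 1 (j268106) = engine 2 (j269294): `m = 360` EQUAL, dev. ≤ 1.8e-13, checks true; twist `E^D` (j269294): `N_F = 810759098310`, `#tors·∏c·#Ш_an = 1·60·9` — `ord_5 #Ш_an(E^D) = 0`, `ord_5 ∏c(E^D) = 1` — BSD-consistent. Jetchev MAX-form: `ord_5 #Ш(E/ℚ) ≤ 2(w − w) = 0 = ord_5 #Ш_an` ⇒ Miller's `BSD(E,5)` modulo the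
displayed binders (`hMJ` FLAGGED `Miller11-Thm54-Cha-case`, `JET@p|N`; `hGZK`; Heegner datum; `hv`; `hr`; `hs`). Kernel: `Δ ≠ 0`,
global minimality (bounded Kraus criterion), `5 ∣ Δ ∧ 5 ∤ c₄`, `E[5]` irreducible (`ℓ = 11`, `#Ẽ(𝔽_11) = 11`, `a_11 = 1`, `X² − a_ℓX + ℓ` root-free
mod `5`), `c_5(W/ℚ_5) = 5` (`TamLocal` ⟨5, 2, 1, 1, 0, 0, 0, 5, 0, 0, 5⟩). Per pair; LITERAL currency; nothing booked.
[cite: Miller2011LMS, Thm. 5.4 (arXiv:1010.2431 p. 11) and Def. 1.1] [cite: Jetchev2008, Thm. 1.1] [cite: Mazur1978, §6 Prop. 6.3 (1) (p. 153)]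
[cite: Silverman1994, IV.9.4] [cite: Cremona2006, Table 1 (label 355110cd1)] -/
theorem bsdp_j355110cd1_5 (hMJ : thm54_cha_padicValNat_shaOrder_add_tamagawa_le)
    (hGZK : rank_eq_analyticRank_of_analyticRank_le_one) (W : WeierstrassCurve ℚ)
    (hW : W = ⟨1, 0, 0, -556275, -159738093⟩) {N : ℕ} [NeZero N] {K : Type} [Field K] [NumberField K]
    (hK : IsImaginaryQuadratic K) (hH : SatisfiesHeegnerHypothesis N K) {P : (W.baseChange K).toAffine.Point}
    (hP : IsHeegnerPoint N W K P) (hnt : ¬ IsOfFinAddOrder P) (hpD : ¬ (5 : ℤ) ∣ NumberField.discr K)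
    (hpN : ¬ 5 ^ 2 ∣ N) (hqN : 5 ∣ N) (hv : padicValNat 5 (AddSubgroup.zmultiples P).index ≤ 1)
    (hr : W.analyticRank ≤ 1) {s : ℚ} (hs : shaAn W = (s : ℂ)) (hvs : padicValRat 5 s = 0) : BSDp W 5 :=
  bsdp_prime_of_jetchevIndex_of_tamLocal 5 (by norm_num) (by norm_num) 1 0 0 (-556275) (-159738093) (by decide +kernel)
    (by decide +kernel) (by decide +kernel) (by decide +kernel) (by decide +kernel) 11 (by norm_num) (by norm_num) (by norm_num)
    (by decide +kernel) (n := 11) (by decide +kernel) (by decide +kernel) 5 (by norm_num) (T := ⟨5, 2, 1, 1, 0, 0, 0, 5, 0, 0, 5⟩) rfl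
    (by decide +kernel) (c := 5) (by decide +kernel) (w := 1) (by decide +kernel) hMJ hGZK W hW hK hH hP hnt (mod_cast hpD)
    hpN hqN hv hr hs hvs

/-- **`BSD(E,5)` for `360570be1`** (`N = 360570 = 2·3·5·7·17·101`; NON-SPLIT MULTIPLICATIVE at `5` (Kodaira `I3`, `c_5 = 1`); `#tors = 3`, `∏c = 90`,
`r_an = 1`, `#Ш_an = 1`, `ρ̄_{E,5}` onto (Cremona galrep: 3B.1.1); lane residue cell `(5, X11b)` (bsdN v4u/v5u of record: `residue:X11b`);
ALSO the unit's GEN 10 beyond-window DATA record in `X11b/BeyondWindowRecords46.lean` (binders as displayed there)). Tamagawa-OBSTRUCTED, shape J1: the ONLY prime `q ∣ N` with `5 ∣ c_q` is `q = 7` (Kodaira `I15` split, `c_7 = 15`, `w = ord_5 c_7 = 1`) — engines A (Tate `tateY`) = B (PARI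
`elllocalred`, j269294) = C (observatory `TamLocal` ⟨7, 2, 1, 0, 0, 0, 0, 15, 0, 0, 15⟩, re-checked by the kernel below). Lane fields of record (`|D| ≤ 1511`): `-671`: `m = 300` (`ord = 2`).
DEEP FIELD `D = -1511` (prime): **`m = [E(K):ℤy_K] = 240`, `ord_5 m = 1 = w`** (`ρ = 14400`; `L'(E,1) = 6.997869376`, `L(E^D,1) = 1.227931151`, `ĥ(x) = 6.332382186`; `N_{E^D} = 823224938970`)
— engine 1 (j268106) = engine 2 (j269294): `m = 240` EQUAL, dev. ≤ 4.2e-14, checks true; twist `E^D` (j269294): `N_F = 823224938970`, `#tors·∏c·#Ш_an = 1·180·16` — `ord_5 #Ш_an(E^D) = 0`, `ord_5 ∏c(E^D) = 1` — BSD-consistent. Jetchev MAX-form: `ord_5 #Ш(E/ℚ) ≤ 2(w − w) = 0 = ord_5 #Ш_an` ⇒ Miller's `BSD(E,5)` modulo the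
displayed binders (`hMJ` FLAGGED `Miller11-Thm54-Cha-case`, `JET@p|N`; `hGZK`; Heegner datum; `hv`; `hr`; `hs`). Kernel: `Δ ≠ 0`,
global minimality (bounded Kraus criterion), `5 ∣ Δ ∧ 5 ∤ c₄`, `E[5]` irreducible (`ℓ = 13`, `#Ẽ(𝔽_13) = 21`, `a_13 = -7`, `X² − a_ℓX + ℓ` root-free
mod `5`), `c_7(W/ℚ_7) = 15` (`TamLocal` ⟨7, 2, 1, 0, 0, 0, 0, 15, 0, 0, 15⟩). Per pair; LITERAL currency; nothing booked.
[cite: Miller2011LMS, Thm. 5.4 (arXiv:1010.2431 p. 11) and Def. 1.1] [cite: Jetchev2008, Thm. 1.1] [cite: Mazur1978, §6 Prop. 6.3 (1) (p. 153)]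
[cite: Silverman1994, IV.9.4] [cite: Cremona2006, Table 1 (label 360570be1)] -/
theorem bsdp_j360570be1_5 (hMJ : thm54_cha_padicValNat_shaOrder_add_tamagawa_le)
    (hGZK : rank_eq_analyticRank_of_analyticRank_le_one) (W : WeierstrassCurve ℚ)
    (hW : W = ⟨1, 0, 1, -430351289, 3436200860636⟩) {N : ℕ} [NeZero N] {K : Type} [Field K] [NumberField K]
    (hK : IsImaginaryQuadratic K) (hH : SatisfiesHeegnerHypothesis N K) {P : (W.baseChange K).toAffine.Point}
    (hP : IsHeegnerPoint N W K P) (hnt : ¬ IsOfFinAddOrder P) (hpD : ¬ (5 : ℤ) ∣ NumberField.discr K)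
    (hpN : ¬ 5 ^ 2 ∣ N) (hqN : 7 ∣ N) (hv : padicValNat 5 (AddSubgroup.zmultiples P).index ≤ 1)
    (hr : W.analyticRank ≤ 1) {s : ℚ} (hs : shaAn W = (s : ℂ)) (hvs : padicValRat 5 s = 0) : BSDp W 5 :=
  bsdp_prime_of_jetchevIndex_of_tamLocal 5 (by norm_num) (by norm_num) 1 0 1 (-430351289) 3436200860636 (by decide +kernel)
    (by decide +kernel) (by decide +kernel) (by decide +kernel) (by decide +kernel) 13 (by norm_num) (by norm_num) (by norm_num)
    (by decide +kernel) (n := 21) (by decide +kernel) (by decide +kernel) 7 (by norm_num) (T := ⟨7, 2, 1, 0, 0, 0, 0, 15, 0, 0, 15⟩) rfl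
    (by decide +kernel) (c := 15) (by decide +kernel) (w := 1) (by decide +kernel) hMJ hGZK W hW hK hH hP hnt (mod_cast hpD)
    hpN hqN hv hr hs hvs

/-- **`BSD(E,5)` for `365490r1`** (`N = 365490 = 2·3²·5·31·131`; NON-SPLIT MULTIPLICATIVE at `5` (Kodaira `I11`, `c_5 = 1`); `#tors = 1`, `∏c = 120`,
`r_an = 1`, `#Ш_an = 1`, `ρ̄_{E,5}` onto (Cremona galrep: no code); lane residue cell `(5, X11b)` (bsdN v4u/v5u of record: `residue:X11b`);
ALSO the unit's GEN 10 beyond-window DATA record in `X11b/BeyondWindowRecords47.lean` (binders as displayed there)). Tamagawa-OBSTRUCTED, shape J1: the ONLY prime `q ∣ N` with `5 ∣ c_q` is `q = 31` (Kodaira `I5` split, `c_31 = 5`, `w = ord_5 c_31 = 1`) — engines A (Tate `tateY`) = B (PARI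
`elllocalred`, j269294) = C (observatory `TamLocal` ⟨31, 5, 1, 12, 0, 0, 0, 5, 0, 0, 5⟩, re-checked by the kernel below). Lane fields of record (`|D| ≤ 1511`): `-119`: `m = 1200` (`ord = 2`); `-959`: `m = 1200` (`ord = 2`).
DEEP FIELD `D = -1511` (prime): **`m = [E(K):ℤy_K] = 1440`, `ord_5 m = 1 = w`** (`ρ = 518400`; `L'(E,1) = 11.2128204`, `L(E^D,1) = 2.094486215`, `ĥ(x) = 1.31801194`; `N_{E^D} = 834457894290`)
— engine 1 (j268106) = engine 2 (j269294): `m = 1440` EQUAL, dev. ≤ 1.3e-13, checks true; twist `E^D` (j269294): `N_F = 834457894290`, `#tors·∏c·#Ш_an = 1·240·36` — `ord_5 #Ш_an(E^D) = 0`, `ord_5 ∏c(E^D) = 1` — BSD-consistent. Jetchev MAX-form: `ord_5 #Ш(E/ℚ) ≤ 2(w − w) = 0 = ord_5 #Ш_an` ⇒ Miller's `BSD(E,5)` modulo the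
displayed binders (`hMJ` FLAGGED `Miller11-Thm54-Cha-case`, `JET@p|N`; `hGZK`; Heegner datum; `hv`; `hr`; `hs`). Kernel: `Δ ≠ 0`,
global minimality (bounded Kraus criterion), `5 ∣ Δ ∧ 5 ∤ c₄`, `E[5]` irreducible (`ℓ = 7`, `#Ẽ(𝔽_7) = 9`, `a_7 = -1`, `X² − a_ℓX + ℓ` root-free
mod `5`), `c_31(W/ℚ_31) = 5` (`TamLocal` ⟨31, 5, 1, 12, 0, 0, 0, 5, 0, 0, 5⟩). Per pair; LITERAL currency; nothing booked.
[cite: Miller2011LMS, Thm. 5.4 (arXiv:1010.2431 p. 11) and Def. 1.1] [cite: Jetchev2008, Thm. 1.1] [cite: Mazur1978, §6 Prop. 6.3 (1) (p. 153)]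
[cite: Silverman1994, IV.9.4] [cite: Cremona2006, Table 1 (label 365490r1)] -/
theorem bsdp_j365490r1_5 (hMJ : thm54_cha_padicValNat_shaOrder_add_tamagawa_le)
    (hGZK : rank_eq_analyticRank_of_analyticRank_le_one) (W : WeierstrassCurve ℚ)
    (hW : W = ⟨1, -1, 1, -4118074943, 101717083298607⟩) {N : ℕ} [NeZero N] {K : Type} [Field K] [NumberField K]
    (hK : IsImaginaryQuadratic K) (hH : SatisfiesHeegnerHypothesis N K) {P : (W.baseChange K).toAffine.Point}
    (hP : IsHeegnerPoint N W K P) (hnt : ¬ IsOfFinAddOrder P) (hpD : ¬ (5 : ℤ) ∣ NumberField.discr K)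
    (hpN : ¬ 5 ^ 2 ∣ N) (hqN : 31 ∣ N) (hv : padicValNat 5 (AddSubgroup.zmultiples P).index ≤ 1)
    (hr : W.analyticRank ≤ 1) {s : ℚ} (hs : shaAn W = (s : ℂ)) (hvs : padicValRat 5 s = 0) : BSDp W 5 :=
  bsdp_prime_of_jetchevIndex_of_tamLocal 5 (by norm_num) (by norm_num) 1 (-1) 1 (-4118074943) 101717083298607 (by decide +kernel)
    (by decide +kernel) (by decide +kernel) (by decide +kernel) (by decide +kernel) 7 (by norm_num) (by norm_num) (by norm_num)
    (by decide +kernel) (n := 9) (by decide +kernel) (by decide +kernel) 31 (by norm_num) (T := ⟨31, 5, 1, 12, 0, 0, 0, 5, 0, 0, 5⟩) rfl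
    (by decide +kernel) (c := 5) (by decide +kernel) (w := 1) (by decide +kernel) hMJ hGZK W hW hK hH hP hnt (mod_cast hpD)
    hpN hqN hv hr hs hvs

/-- **`BSD(E,5)` for `367710cl1`** (`N = 367710 = 2·3·5·7·17·103`; SPLIT MULTIPLICATIVE at `5` (Kodaira `I12`, `c_5 = 12`); `#tors = 2`, `∏c = 23040`,
`r_an = 1`, `#Ш_an = 1`, `ρ̄_{E,5}` onto (Cremona galrep: 2B); lane residue cell `(5, X11b)` (bsdN v4u/v5u of record: `residue:X11b`);
ALSO the unit's GEN 10 beyond-window DATA record in `X11b/BeyondWindowRecords48.lean` (binders as displayed there)). Tamagawa-OBSTRUCTED, shape J1: the ONLY prime `q ∣ N` with `5 ∣ c_q` is `q = 7` (Kodaira `I5` split, `c_7 = 5`, `w = ord_5 c_7 = 1`) — engines A (Tate `tateY`) = B (PARI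
`elllocalred`, j269294) = C (observatory `TamLocal` ⟨7, 2, 1, 5, 0, 0, 0, 5, 0, 0, 5⟩, re-checked by the kernel below). Lane fields of record (`|D| ≤ 1511`): none.
DEEP FIELD `D = -5759` (13·443): **`m = [E(K):ℤy_K] = 46080`, `ord_5 m = 1 = w`** (`ρ = 530841600`; `L'(E,1) = 18.76343845`, `L(E^D,1) = 24.25339351`, `ĥ(x) = 0.09681130589`; `N_{E^D} = 12195499644510`)
— engine 1 (j268106) = engine 2 (j269294): `m = 46080` EQUAL, dev. ≤ 2.1e-13, checks true; twist `E^D` (j269294): `N_F = 12195499644510`, `#tors·∏c·#Ш_an = 2·92160·4` — `ord_5 #Ш_an(E^D) = 0`, `ord_5 ∏c(E^D) = 1` — BSD-consistent. Jetchev MAX-form: `ord_5 #Ш(E/ℚ) ≤ 2(w − w) = 0 = ord_5 #Ш_an` ⇒ Miller's `BSD(E,5)` modulo the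
displayed binders (`hMJ` FLAGGED `Miller11-Thm54-Cha-case`, `JET@p|N`; `hGZK`; Heegner datum; `hv`; `hr`; `hs`). Kernel: `Δ ≠ 0`,
global minimality (bounded Kraus criterion), `5 ∣ Δ ∧ 5 ∤ c₄`, `E[5]` irreducible (`ℓ = 19`, `#Ẽ(𝔽_19) = 18`, `a_19 = 2`, `X² − a_ℓX + ℓ` root-free
mod `5`), `c_7(W/ℚ_7) = 5` (`TamLocal` ⟨7, 2, 1, 5, 0, 0, 0, 5, 0, 0, 5⟩). Per pair; LITERAL currency; nothing booked.
[cite: Miller2011LMS, Thm. 5.4 (arXiv:1010.2431 p. 11) and Def. 1.1] [cite: Jetchev2008, Thm. 1.1] [cite: Mazur1978, §6 Prop. 6.3 (1) (p. 153)]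
[cite: Silverman1994, IV.9.4] [cite: Cremona2006, Table 1 (label 367710cl1)] -/
theorem bsdp_j367710cl1_5 (hMJ : thm54_cha_padicValNat_shaOrder_add_tamagawa_le)
    (hGZK : rank_eq_analyticRank_of_analyticRank_le_one) (W : WeierstrassCurve ℚ)
    (hW : W = ⟨1, 0, 0, -3285561605, 70917361880577⟩) {N : ℕ} [NeZero N] {K : Type} [Field K] [NumberField K]
    (hK : IsImaginaryQuadratic K) (hH : SatisfiesHeegnerHypothesis N K) {P : (W.baseChange K).toAffine.Point}
    (hP : IsHeegnerPoint N W K P) (hnt : ¬ IsOfFinAddOrder P) (hpD : ¬ (5 : ℤ) ∣ NumberField.discr K)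
    (hpN : ¬ 5 ^ 2 ∣ N) (hqN : 7 ∣ N) (hv : padicValNat 5 (AddSubgroup.zmultiples P).index ≤ 1)
    (hr : W.analyticRank ≤ 1) {s : ℚ} (hs : shaAn W = (s : ℂ)) (hvs : padicValRat 5 s = 0) : BSDp W 5 :=
  bsdp_prime_of_jetchevIndex_of_tamLocal 5 (by norm_num) (by norm_num) 1 0 0 (-3285561605) 70917361880577 (by decide +kernel)
    (by decide +kernel) (by decide +kernel) (by decide +kernel) (by decide +kernel) 19 (by norm_num) (by norm_num) (by norm_num)
    (by decide +kernel) (n := 18) (by decide +kernel) (by decide +kernel) 7 (by norm_num) (T := ⟨7, 2, 1, 5, 0, 0, 0, 5, 0, 0, 5⟩) rfl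
    (by decide +kernel) (c := 5) (by decide +kernel) (w := 1) (by decide +kernel) hMJ hGZK W hW hK hH hP hnt (mod_cast hpD)
    hpN hqN hv hr hs hvs

/-- **`BSD(E,5)` for `370110ce1`** (`N = 370110 = 2·3·5·13²·73`; SPLIT MULTIPLICATIVE at `5` (Kodaira `I5`, `c_5 = 5`); `#tors = 1`, `∏c = 1260`,
`r_an = 1`, `#Ш_an = 1`, `ρ̄_{E,5}` onto (Cremona galrep: no code); lane residue cell `(5, X11b)` (bsdN v4u/v5u of record: `residue:X11b`);
ALSO the unit's GEN 10 beyond-window DATA record in `X11b/BeyondWindowRecords48.lean` (binders as displayed there)). Tamagawa-OBSTRUCTED, shape J1: the ONLY prime `q ∣ N` with `5 ∣ c_q` is `q = p = 5` itself (Kodaira `I5` split, `c_5 = 5`, `w = ord_5 c_5 = 1`) — engines A (Tate `tateY`) = B (PARI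
`elllocalred`, j269294) = C (observatory `TamLocal` ⟨5, 2, 1, 0, 0, 0, 0, 5, 0, 0, 5⟩, re-checked by the kernel below). Lane fields of record (`|D| ≤ 1511`): `-911`: `m = 12600` (`ord = 2`); `-1031`: `m = 12600` (`ord = 2`).
DEEP FIELD `D = -1751` (17·103): **`m = [E(K):ℤy_K] = 5040`, `ord_5 m = 1 = w`** (`ρ = 6350400`; `L'(E,1) = 18.00779671`, `L(E^D,1) = 2.491615932`, `ĥ(x) = 0.1884472549`; `N_{E^D} = 1134757630110`)
— engine 1 (j268106) = engine 2 (j269294): `m = 5040` EQUAL, dev. ≤ 6.2e-14, checks true; twist `E^D` (j269294): `N_F = 1134757630110`, `#tors·∏c·#Ш_an = 1·10080·1` — `ord_5 #Ш_an(E^D) = 0`, `ord_5 ∏c(E^D) = 1` — BSD-consistent. Jetchev MAX-form: `ord_5 #Ш(E/ℚ) ≤ 2(w − w) = 0 = ord_5 #Ш_an` ⇒ Miller's `BSD(E,5)` modulo the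
displayed binders (`hMJ` FLAGGED `Miller11-Thm54-Cha-case`, `JET@p|N`; `hGZK`; Heegner datum; `hv`; `hr`; `hs`). Kernel: `Δ ≠ 0`,
global minimality (bounded Kraus criterion), `5 ∣ Δ ∧ 5 ∤ c₄`, `E[5]` irreducible (`ℓ = 11`, `#Ẽ(𝔽_11) = 13`, `a_11 = -1`, `X² − a_ℓX + ℓ` root-free
mod `5`), `c_5(W/ℚ_5) = 5` (`TamLocal` ⟨5, 2, 1, 0, 0, 0, 0, 5, 0, 0, 5⟩). Per pair; LITERAL currency; nothing booked.
[cite: Miller2011LMS, Thm. 5.4 (arXiv:1010.2431 p. 11) and Def. 1.1] [cite: Jetchev2008, Thm. 1.1] [cite: Mazur1978, §6 Prop. 6.3 (1) (p. 153)]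
[cite: Silverman1994, IV.9.4] [cite: Cremona2006, Table 1 (label 370110ce1)] -/
theorem bsdp_j370110ce1_5 (hMJ : thm54_cha_padicValNat_shaOrder_add_tamagawa_le)
    (hGZK : rank_eq_analyticRank_of_analyticRank_le_one) (W : WeierstrassCurve ℚ)
    (hW : W = ⟨1, 0, 0, -2836766995, 58154306821025⟩) {N : ℕ} [NeZero N] {K : Type} [Field K] [NumberField K]
    (hK : IsImaginaryQuadratic K) (hH : SatisfiesHeegnerHypothesis N K) {P : (W.baseChange K).toAffine.Point}
    (hP : IsHeegnerPoint N W K P) (hnt : ¬ IsOfFinAddOrder P) (hpD : ¬ (5 : ℤ) ∣ NumberField.discr K)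
    (hpN : ¬ 5 ^ 2 ∣ N) (hqN : 5 ∣ N) (hv : padicValNat 5 (AddSubgroup.zmultiples P).index ≤ 1)
    (hr : W.analyticRank ≤ 1) {s : ℚ} (hs : shaAn W = (s : ℂ)) (hvs : padicValRat 5 s = 0) : BSDp W 5 :=
  bsdp_prime_of_jetchevIndex_of_tamLocal 5 (by norm_num) (by norm_num) 1 0 0 (-2836766995) 58154306821025 (by decide +kernel)
    (by decide +kernel) (by decide +kernel) (by decide +kernel) (by decide +kernel) 11 (by norm_num) (by norm_num) (by norm_num)
    (by decide +kernel) (n := 13) (by decide +kernel) (by decide +kernel) 5 (by norm_num) (T := ⟨5, 2, 1, 0, 0, 0, 0, 5, 0, 0, 5⟩) rfl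
    (by decide +kernel) (c := 5) (by decide +kernel) (w := 1) (by decide +kernel) hMJ hGZK W hW hK hH hP hnt (mod_cast hpD)
    hpN hqN hv hr hs hvs

/-- **`BSD(E,5)` for `379890h1`** (`N = 379890 = 2·3⁴·5·7·67`; NON-SPLIT MULTIPLICATIVE at `5` (Kodaira `I14`, `c_5 = 2`); `#tors = 1`, `∏c = 20`,
`r_an = 1`, `#Ш_an = 1`, `ρ̄_{E,5}` onto (Cremona galrep: no code); lane residue cell `(5, X11b)` (bsdN v4u/v5u of record: `residue:X11b`);
ALSO the unit's GEN 10 beyond-window DATA record in `X11b/BeyondWindowRecords49.lean` (binders as displayed there)). Tamagawa-OBSTRUCTED, shape J1: the ONLY prime `q ∣ N` with `5 ∣ c_q` is `q = 7` (Kodaira `I5` split, `c_7 = 5`, `w = ord_5 c_7 = 1`) — engines A (Tate `tateY`) = B (PARI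
`elllocalred`, j269294) = C (observatory `TamLocal` ⟨7, 2, 1, 4, 0, 0, 0, 5, 0, 0, 5⟩, re-checked by the kernel below). Lane fields of record (`|D| ≤ 1511`): `-311`: `m = 200` (`ord = 2`).
DEEP FIELD `D = -1319` (prime): **`m = [E(K):ℤy_K] = 120`, `ord_5 m = 1 = w`** (`ρ = 3600`; `L'(E,1) = 3.687153506`, `L(E^D,1) = 0.2527900658`, `ĥ(x) = 3.533385411`; `N_{E^D} = 660917806290`)
— engine 1 (j268106) = engine 2 (j269294): `m = 120` EQUAL, dev. ≤ 2.0e-15, checks true; twist `E^D` (j269294): `N_F = 660917806290`, `#tors·∏c·#Ш_an = 1·40·9` — `ord_5 #Ш_an(E^D) = 0`, `ord_5 ∏c(E^D) = 1` — BSD-consistent. Jetchev MAX-form: `ord_5 #Ш(E/ℚ) ≤ 2(w − w) = 0 = ord_5 #Ш_an` ⇒ Miller's `BSD(E,5)` modulo the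
displayed binders (`hMJ` FLAGGED `Miller11-Thm54-Cha-case`, `JET@p|N`; `hGZK`; Heegner datum; `hv`; `hr`; `hs`). Kernel: `Δ ≠ 0`,
global minimality (bounded Kraus criterion), `5 ∣ Δ ∧ 5 ∤ c₄`, `E[5]` irreducible (`ℓ = 11`, `#Ẽ(𝔽_11) = 16`, `a_11 = -4`, `X² − a_ℓX + ℓ` root-free
mod `5`), `c_7(W/ℚ_7) = 5` (`TamLocal` ⟨7, 2, 1, 4, 0, 0, 0, 5, 0, 0, 5⟩). Per pair; LITERAL currency; nothing booked.
[cite: Miller2011LMS, Thm. 5.4 (arXiv:1010.2431 p. 11) and Def. 1.1] [cite: Jetchev2008, Thm. 1.1] [cite: Mazur1978, §6 Prop. 6.3 (1) (p. 153)]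
[cite: Silverman1994, IV.9.4] [cite: Cremona2006, Table 1 (label 379890h1)] -/
theorem bsdp_j379890h1_5 (hMJ : thm54_cha_padicValNat_shaOrder_add_tamagawa_le)
    (hGZK : rank_eq_analyticRank_of_analyticRank_le_one) (W : WeierstrassCurve ℚ)
    (hW : W = ⟨1, -1, 0, -47413275, 458678650661⟩) {N : ℕ} [NeZero N] {K : Type} [Field K] [NumberField K]
    (hK : IsImaginaryQuadratic K) (hH : SatisfiesHeegnerHypothesis N K) {P : (W.baseChange K).toAffine.Point}
    (hP : IsHeegnerPoint N W K P) (hnt : ¬ IsOfFinAddOrder P) (hpD : ¬ (5 : ℤ) ∣ NumberField.discr K)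
    (hpN : ¬ 5 ^ 2 ∣ N) (hqN : 7 ∣ N) (hv : padicValNat 5 (AddSubgroup.zmultiples P).index ≤ 1)
    (hr : W.analyticRank ≤ 1) {s : ℚ} (hs : shaAn W = (s : ℂ)) (hvs : padicValRat 5 s = 0) : BSDp W 5 :=
  bsdp_prime_of_jetchevIndex_of_tamLocal 5 (by norm_num) (by norm_num) 1 (-1) 0 (-47413275) 458678650661 (by decide +kernel)
    (by decide +kernel) (by decide +kernel) (by decide +kernel) (by decide +kernel) 11 (by norm_num) (by norm_num) (by norm_num)
    (by decide +kernel) (n := 16) (by decide +kernel) (by decide +kernel) 7 (by norm_num) (T := ⟨7, 2, 1, 4, 0, 0, 0, 5, 0, 0, 5⟩) rfl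
    (by decide +kernel) (c := 5) (by decide +kernel) (w := 1) (by decide +kernel) hMJ hGZK W hW hK hH hP hnt (mod_cast hpD)
    hpN hqN hv hr hs hvs

/-- **`BSD(E,5)` for `381570ca1`** (`N = 381570 = 2·3·5·7·23·79`; NON-SPLIT MULTIPLICATIVE at `5` (Kodaira `I5`, `c_5 = 1`); `#tors = 1`, `∏c = 20`,
`r_an = 1`, `#Ш_an = 1`, `ρ̄_{E,5}` onto (Cremona galrep: no code); lane residue cell `(5, X11b)` (bsdN v4u/v5u of record: `residue:X11b`);
ALSO the unit's GEN 10 beyond-window DATA record in `X11b/BeyondWindowRecords49.lean` (binders as displayed there)). Tamagawa-OBSTRUCTED, shape J1: the ONLY prime `q ∣ N` with `5 ∣ c_q` is `q = 2` (Kodaira `I5` split, `c_2 = 5`, `w = ord_5 c_2 = 1`) — engines A (Tate `tateY`) = B (PARI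
`elllocalred`, j269294) = C (observatory `TamLocal` ⟨2, 1, 1, 0, 0, 0, 0, 5, 0, 0, 5⟩, re-checked by the kernel below). Lane fields of record (`|D| ≤ 1511`): `-551`: `m = 200` (`ord = 2`).
DEEP FIELD `D = -5351` (prime): **`m = [E(K):ℤy_K] = 40`, `ord_5 m = 1 = w`** (`ρ = 400`; `L'(E,1) = 14.87389738`, `L(E^D,1) = 0.1038159903`, `ĥ(x) = 1.736906403`; `N_{E^D} = 10925570505570`)
— engine 1 (j268106) = engine 2 (j269294): `m = 40` EQUAL, dev. ≤ 5.6e-13, checks true; twist `E^D` (j269294): `N_F = 10925570505570`, `#tors·∏c·#Ш_an = 1·40·1` — `ord_5 #Ш_an(E^D) = 0`, `ord_5 ∏c(E^D) = 1` — BSD-consistent. Jetchev MAX-form: `ord_5 #Ш(E/ℚ) ≤ 2(w − w) = 0 = ord_5 #Ш_an` ⇒ Miller's `BSD(E,5)` modulo the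
displayed binders (`hMJ` FLAGGED `Miller11-Thm54-Cha-case`, `JET@p|N`; `hGZK`; Heegner datum; `hv`; `hr`; `hs`). Kernel: `Δ ≠ 0`,
global minimality (bounded Kraus criterion), `5 ∣ Δ ∧ 5 ∤ c₄`, `E[5]` irreducible (`ℓ = 17`, `#Ẽ(𝔽_17) = 18`, `a_17 = 0`, `X² − a_ℓX + ℓ` root-free
mod `5`), `c_2(W/ℚ_2) = 5` (`TamLocal` ⟨2, 1, 1, 0, 0, 0, 0, 5, 0, 0, 5⟩). Per pair; LITERAL currency; nothing booked.
[cite: Miller2011LMS, Thm. 5.4 (arXiv:1010.2431 p. 11) and Def. 1.1] [cite: Jetchev2008, Thm. 1.1] [cite: Mazur1978, §6 Prop. 6.3 (1) (p. 153)]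
[cite: Silverman1994, IV.9.4] [cite: Cremona2006, Table 1 (label 381570ca1)] -/
theorem bsdp_j381570ca1_5 (hMJ : thm54_cha_padicValNat_shaOrder_add_tamagawa_le)
    (hGZK : rank_eq_analyticRank_of_analyticRank_le_one) (W : WeierstrassCurve ℚ)
    (hW : W = ⟨1, 0, 0, -20006, 2143236⟩) {N : ℕ} [NeZero N] {K : Type} [Field K] [NumberField K]
    (hK : IsImaginaryQuadratic K) (hH : SatisfiesHeegnerHypothesis N K) {P : (W.baseChange K).toAffine.Point}
    (hP : IsHeegnerPoint N W K P) (hnt : ¬ IsOfFinAddOrder P) (hpD : ¬ (5 : ℤ) ∣ NumberField.discr K)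
    (hpN : ¬ 5 ^ 2 ∣ N) (hqN : 2 ∣ N) (hv : padicValNat 5 (AddSubgroup.zmultiples P).index ≤ 1)
    (hr : W.analyticRank ≤ 1) {s : ℚ} (hs : shaAn W = (s : ℂ)) (hvs : padicValRat 5 s = 0) : BSDp W 5 :=
  bsdp_prime_of_jetchevIndex_of_tamLocal 5 (by norm_num) (by norm_num) 1 0 0 (-20006) 2143236 (by decide +kernel)
    (by decide +kernel) (by decide +kernel) (by decide +kernel) (by decide +kernel) 17 (by norm_num) (by norm_num) (by norm_num)
    (by decide +kernel) (n := 18) (by decide +kernel) (by decide +kernel) 2 (by norm_num) (T := ⟨2, 1, 1, 0, 0, 0, 0, 5, 0, 0, 5⟩) rfl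
    (by decide +kernel) (c := 5) (by decide +kernel) (w := 1) (by decide +kernel) hMJ hGZK W hW hK hH hP hnt (mod_cast hpD)
    hpN hqN hv hr hs hvs

/-- **`BSD(E,5)` for `383040dq1`** (`N = 383040 = 2⁶·3²·5·7·19`; NON-SPLIT MULTIPLICATIVE at `5` (Kodaira `I2`, `c_5 = 2`); `#tors = 2`, `∏c = 320`,
`r_an = 1`, `#Ш_an = 1`, `ρ̄_{E,5}` onto (Cremona galrep: 2B); lane residue cell `(5, X11b)` (bsdN v4u/v5u of record: `residue:X11b`);
ALSO the unit's GEN 10 beyond-window DATA record in `X11b/BeyondWindowRecords50.lean` (binders as displayed there)). Tamagawa-OBSTRUCTED, shape J1: the ONLY prime `q ∣ N` with `5 ∣ c_q` is `q = 19` (Kodaira `I5` split, `c_19 = 5`, `w = ord_5 c_19 = 1`) — engines A (Tate `tateY`) = B (PARI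
`elllocalred`, j269294) = C (observatory `TamLocal` ⟨19, 4, 1, 8, 0, 0, 0, 5, 0, 0, 5⟩, re-checked by the kernel below). Lane fields of record (`|D| ≤ 1511`): `-839`: `m = 1600` (`ord = 2`).
DEEP FIELD `D = -1991` (11·181): **`m = [E(K):ℤy_K] = 960`, `ord_5 m = 1 = w`** (`ρ = 230400`; `L'(E,1) = 8.886072958`, `L(E^D,1) = 1.595647456`, `ĥ(x) = 8.674812482`; `N_{E^D} = 1518401586240`)
— engine 1 (j268106) = engine 2 (j269294): `m = 960` EQUAL, dev. ≤ 4.6e-14, checks true; twist `E^D` (j269294): `N_F = 1518401586240`, `#tors·∏c·#Ш_an = 2·1280·9` — `ord_5 #Ш_an(E^D) = 0`, `ord_5 ∏c(E^D) = 1` — BSD-consistent. Jetchev MAX-form: `ord_5 #Ш(E/ℚ) ≤ 2(w − w) = 0 = ord_5 #Ш_an` ⇒ Miller's `BSD(E,5)` modulo the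
displayed binders (`hMJ` FLAGGED `Miller11-Thm54-Cha-case`, `JET@p|N`; `hGZK`; Heegner datum; `hv`; `hr`; `hs`). Kernel: `Δ ≠ 0`,
global minimality (bounded Kraus criterion), `5 ∣ Δ ∧ 5 ∤ c₄`, `E[5]` irreducible (`ℓ = 11`, `#Ẽ(𝔽_11) = 6`, `a_11 = 6`, `X² − a_ℓX + ℓ` root-free
mod `5`), `c_19(W/ℚ_19) = 5` (`TamLocal` ⟨19, 4, 1, 8, 0, 0, 0, 5, 0, 0, 5⟩). Per pair; LITERAL currency; nothing booked.
[cite: Miller2011LMS, Thm. 5.4 (arXiv:1010.2431 p. 11) and Def. 1.1] [cite: Jetchev2008, Thm. 1.1] [cite: Mazur1978, §6 Prop. 6.3 (1) (p. 153)]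
[cite: Silverman1994, IV.9.4] [cite: Cremona2006, Table 1 (label 383040dq1)] -/
theorem bsdp_j383040dq1_5 (hMJ : thm54_cha_padicValNat_shaOrder_add_tamagawa_le)
    (hGZK : rank_eq_analyticRank_of_analyticRank_le_one) (W : WeierstrassCurve ℚ)
    (hW : W = ⟨0, 0, 0, -19351758828, -1031348035930448⟩) {N : ℕ} [NeZero N] {K : Type} [Field K] [NumberField K]
    (hK : IsImaginaryQuadratic K) (hH : SatisfiesHeegnerHypothesis N K) {P : (W.baseChange K).toAffine.Point}
    (hP : IsHeegnerPoint N W K P) (hnt : ¬ IsOfFinAddOrder P) (hpD : ¬ (5 : ℤ) ∣ NumberField.discr K)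
    (hpN : ¬ 5 ^ 2 ∣ N) (hqN : 19 ∣ N) (hv : padicValNat 5 (AddSubgroup.zmultiples P).index ≤ 1)
    (hr : W.analyticRank ≤ 1) {s : ℚ} (hs : shaAn W = (s : ℂ)) (hvs : padicValRat 5 s = 0) : BSDp W 5 :=
  bsdp_prime_of_jetchevIndex_of_tamLocal 5 (by norm_num) (by norm_num) 0 0 0 (-19351758828) (-1031348035930448) (by decide +kernel)
    (by decide +kernel) (by decide +kernel) (by decide +kernel) (by decide +kernel) 11 (by norm_num) (by norm_num) (by norm_num)
    (by decide +kernel) (n := 6) (by decide +kernel) (by decide +kernel) 19 (by norm_num) (T := ⟨19, 4, 1, 8, 0, 0, 0, 5, 0, 0, 5⟩) rfl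
    (by decide +kernel) (c := 5) (by decide +kernel) (w := 1) (by decide +kernel) hMJ hGZK W hW hK hH hP hnt (mod_cast hpD)
    hpN hqN hv hr hs hvs

/-- **`BSD(E,5)` for `383040mo1`** (`N = 383040 = 2⁶·3²·5·7·19`; SPLIT MULTIPLICATIVE at `5` (Kodaira `I3`, `c_5 = 3`); `#tors = 1`, `∏c = 30`,
`r_an = 1`, `#Ш_an = 1`, `ρ̄_{E,5}` onto (Cremona galrep: no code); lane residue cell `(5, X11b)` (bsdN v4u/v5u of record: `residue:X11b`);
ALSO the unit's GEN 10 beyond-window DATA record in `X11b/BeyondWindowRecords50.lean` (binders as displayed there)). Tamagawa-OBSTRUCTED, shape J1: the ONLY prime `q ∣ N` with `5 ∣ c_q` is `q = 7` (Kodaira `I5` split, `c_7 = 5`, `w = ord_5 c_7 = 1`) — engines A (Tate `tateY`) = B (PARI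
`elllocalred`, j269294) = C (observatory `TamLocal` ⟨7, 2, 1, 2, 0, 0, 0, 5, 0, 0, 5⟩, re-checked by the kernel below). Lane fields of record (`|D| ≤ 1511`): `-1319`: `m = 300` (`ord = 2`).
DEEP FIELD `D = -1511` (prime): **`m = [E(K):ℤy_K] = 180`, `ord_5 m = 1 = w`** (`ρ = 8100`; `L'(E,1) = 8.057438899`, `L(E^D,1) = 2.88679433`, `ĥ(x) = 0.2545494625`; `N_{E^D} = 874526667840`)
— engine 1 (j268106) = engine 2 (j269294): `m = 180` EQUAL, dev. ≤ 5.8e-14, checks true; twist `E^D` (j269294): `N_F = 874526667840`, `#tors·∏c·#Ш_an = 1·60·9` — `ord_5 #Ш_an(E^D) = 0`, `ord_5 ∏c(E^D) = 1` — BSD-consistent. Jetchev MAX-form: `ord_5 #Ш(E/ℚ) ≤ 2(w − w) = 0 = ord_5 #Ш_an` ⇒ Miller's `BSD(E,5)` modulo the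
displayed binders (`hMJ` FLAGGED `Miller11-Thm54-Cha-case`, `JET@p|N`; `hGZK`; Heegner datum; `hv`; `hr`; `hs`). Kernel: `Δ ≠ 0`,
global minimality (bounded Kraus criterion), `5 ∣ Δ ∧ 5 ∤ c₄`, `E[5]` irreducible (`ℓ = 17`, `#Ẽ(𝔽_17) = 14`, `a_17 = 4`, `X² − a_ℓX + ℓ` root-free
mod `5`), `c_7(W/ℚ_7) = 5` (`TamLocal` ⟨7, 2, 1, 2, 0, 0, 0, 5, 0, 0, 5⟩). Per pair; LITERAL currency; nothing booked.
[cite: Miller2011LMS, Thm. 5.4 (arXiv:1010.2431 p. 11) and Def. 1.1] [cite: Jetchev2008, Thm. 1.1] [cite: Mazur1978, §6 Prop. 6.3 (1) (p. 153)]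
[cite: Silverman1994, IV.9.4] [cite: Cremona2006, Table 1 (label 383040mo1)] -/
theorem bsdp_j383040mo1_5 (hMJ : thm54_cha_padicValNat_shaOrder_add_tamagawa_le)
    (hGZK : rank_eq_analyticRank_of_analyticRank_le_one) (W : WeierstrassCurve ℚ)
    (hW : W = ⟨0, 0, 0, -17412, 884434⟩) {N : ℕ} [NeZero N] {K : Type} [Field K] [NumberField K]
    (hK : IsImaginaryQuadratic K) (hH : SatisfiesHeegnerHypothesis N K) {P : (W.baseChange K).toAffine.Point}
    (hP : IsHeegnerPoint N W K P) (hnt : ¬ IsOfFinAddOrder P) (hpD : ¬ (5 : ℤ) ∣ NumberField.discr K)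
    (hpN : ¬ 5 ^ 2 ∣ N) (hqN : 7 ∣ N) (hv : padicValNat 5 (AddSubgroup.zmultiples P).index ≤ 1)
    (hr : W.analyticRank ≤ 1) {s : ℚ} (hs : shaAn W = (s : ℂ)) (hvs : padicValRat 5 s = 0) : BSDp W 5 :=
  bsdp_prime_of_jetchevIndex_of_tamLocal 5 (by norm_num) (by norm_num) 0 0 0 (-17412) 884434 (by decide +kernel)
    (by decide +kernel) (by decide +kernel) (by decide +kernel) (by decide +kernel) 17 (by norm_num) (by norm_num) (by norm_num)
    (by decide +kernel) (n := 14) (by decide +kernel) (by decide +kernel) 7 (by norm_num) (T := ⟨7, 2, 1, 2, 0, 0, 0, 5, 0, 0, 5⟩) rfl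
    (by decide +kernel) (c := 5) (by decide +kernel) (w := 1) (by decide +kernel) hMJ hGZK W hW hK hH hP hnt (mod_cast hpD)
    hpN hqN hv hr hs hvs

/-- **`BSD(E,5)` for `384720bw1`** (`N = 384720 = 2⁴·3·5·7·229`; NON-SPLIT MULTIPLICATIVE at `5` (Kodaira `I3`, `c_5 = 1`); `#tors = 1`, `∏c = 30`,
`r_an = 1`, `#Ш_an = 1`, `ρ̄_{E,5}` onto (Cremona galrep: no code); lane residue cell `(5, X11b)` (bsdN v4u/v5u of record: `residue:X11b`);
ALSO the unit's GEN 10 beyond-window DATA record in `X11b/BeyondWindowRecords50.lean` (binders as displayed there)). Tamagawa-OBSTRUCTED, shape J1: the ONLY prime `q ∣ N` with `5 ∣ c_q` is `q = 3` (Kodaira `I15` split, `c_3 = 15`, `w = ord_5 c_3 = 1`) — engines A (Tate `tateY`) = B (PARI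
`elllocalred`, j269294) = C (observatory `TamLocal` ⟨3, 1, 1, 2, 0, 0, 0, 15, 0, 0, 15⟩, re-checked by the kernel below). Lane fields of record (`|D| ≤ 1511`): `-311`: `m = 300` (`ord = 2`); `-671`: `m = 300` (`ord = 2`).
DEEP FIELD `D = -1319` (prime): **`m = [E(K):ℤy_K] = 180`, `ord_5 m = 1 = w`** (`ρ = 8100`; `L'(E,1) = 10.60881815`, `L(E^D,1) = 0.6175761502`, `ĥ(x) = 1.290970238`; `N_{E^D} = 669320851920`)
— engine 1 (j268106) = engine 2 (j269294): `m = 180` EQUAL, dev. ≤ 1.2e-13, checks true; twist `E^D` (j269294): `N_F = 669320851920`, `#tors·∏c·#Ш_an = 1·60·9` — `ord_5 #Ш_an(E^D) = 0`, `ord_5 ∏c(E^D) = 1` — BSD-consistent. Jetchev MAX-form: `ord_5 #Ш(E/ℚ) ≤ 2(w − w) = 0 = ord_5 #Ш_an` ⇒ Miller's `BSD(E,5)` modulo the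
displayed binders (`hMJ` FLAGGED `Miller11-Thm54-Cha-case`, `JET@p|N`; `hGZK`; Heegner datum; `hv`; `hr`; `hs`). Kernel: `Δ ≠ 0`,
global minimality (bounded Kraus criterion), `5 ∣ Δ ∧ 5 ∤ c₄`, `E[5]` irreducible (`ℓ = 13`, `#Ẽ(𝔽_13) = 12`, `a_13 = 2`, `X² − a_ℓX + ℓ` root-free
mod `5`), `c_3(W/ℚ_3) = 15` (`TamLocal` ⟨3, 1, 1, 2, 0, 0, 0, 15, 0, 0, 15⟩). Per pair; LITERAL currency; nothing booked.
[cite: Miller2011LMS, Thm. 5.4 (arXiv:1010.2431 p. 11) and Def. 1.1] [cite: Jetchev2008, Thm. 1.1] [cite: Mazur1978, §6 Prop. 6.3 (1) (p. 153)]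
[cite: Silverman1994, IV.9.4] [cite: Cremona2006, Table 1 (label 384720bw1)] -/
theorem bsdp_j384720bw1_5 (hMJ : thm54_cha_padicValNat_shaOrder_add_tamagawa_le)
    (hGZK : rank_eq_analyticRank_of_analyticRank_le_one) (W : WeierstrassCurve ℚ)
    (hW : W = ⟨0, 1, 0, -10909416, 13865542884⟩) {N : ℕ} [NeZero N] {K : Type} [Field K] [NumberField K]
    (hK : IsImaginaryQuadratic K) (hH : SatisfiesHeegnerHypothesis N K) {P : (W.baseChange K).toAffine.Point}
    (hP : IsHeegnerPoint N W K P) (hnt : ¬ IsOfFinAddOrder P) (hpD : ¬ (5 : ℤ) ∣ NumberField.discr K)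
    (hpN : ¬ 5 ^ 2 ∣ N) (hqN : 3 ∣ N) (hv : padicValNat 5 (AddSubgroup.zmultiples P).index ≤ 1)
    (hr : W.analyticRank ≤ 1) {s : ℚ} (hs : shaAn W = (s : ℂ)) (hvs : padicValRat 5 s = 0) : BSDp W 5 :=
  bsdp_prime_of_jetchevIndex_of_tamLocal 5 (by norm_num) (by norm_num) 0 1 0 (-10909416) 13865542884 (by decide +kernel)
    (by decide +kernel) (by decide +kernel) (by decide +kernel) (by decide +kernel) 13 (by norm_num) (by norm_num) (by norm_num)
    (by decide +kernel) (n := 12) (by decide +kernel) (by decide +kernel) 3 (by norm_num) (T := ⟨3, 1, 1, 2, 0, 0, 0, 15, 0, 0, 15⟩) rfl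
    (by decide +kernel) (c := 15) (by decide +kernel) (w := 1) (by decide +kernel) hMJ hGZK W hW hK hH hP hnt (mod_cast hpD)
    hpN hqN hv hr hs hvs

end Summit.BirchSwinnertonDyer.Rank1Residual.X11b

end
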